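import Summits.BirchSwinnertonDyer.BirchSwinnertonDyer.Theses.SylvesterTwoHeegnerIndex
import HarnessLib

/-!
# Route `SylvesterTwoHeegnerIndex` (rung K7t): the join `Assembly`, closed by the kernel bridge

The route's assembly item
`Summit.BirchSwinnertonDyer.BirchSwinnertonDyer.Theses.SylvesterTwoHeegnerIndex.Assembly :=
  HeegnerIndexLowerAtTwoHSY → HeegnerIndexUpperAtTwoHSY → PublishedFactsTwo →
    Summit.BirchSwinnertonDyer.Rank1Residual.X12.CMAtTwo`
is exactly the Theorems-side bridge `CMRungInputs.cmAtTwo_of_inputs` (p406906): on the Hu–Shu–Yin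
family 𝒞_HSY (minimal models of `cubeSumCurve p`, `p ≡ 4, 7 (mod 9)` prime, `3 ∉ 𝔽_p^{×3}`) the two
halves of the `2`-adic Heegner-index identity `ord₂ 𝔮(E_p, K, P) = ord₂ #Ш(E_p)` (the cruxes
`HeegnerIndexLowerAtTwoHSY`, `HeegnerIndexUpperAtTwoHSY`) and the published facts
(`PublishedFactsTwo`) give the rung-K7t leaf `X12.CMAtTwo` (`BSD(E_p, 2)` on 𝒞_HSY) through the landed
`L`-free equivalence `P2.bsdp_two_iff_cmHeegnerIndex`. Nothing is asserted: both cruxes and the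
published facts stay hypotheses of `Assembly` itself; the class 𝒞_HSY at `p = 2` (B14 / O12) stays
OPEN; nothing is booked; no label moves. (Cell `b2b-bsdres` seat x1b GEN 46 = O12 class lead, filing
the closer the cell bsd-cm's HANDOFF names «two (NEED PROVER — not seated): K7t `Assembly` 19232».)
[cite: GrossZagier1986, V.§2 (pp. 310–312)] [cite: HuShuYin2019, Thm. 1.4 (p. 3)]
-/

set_option autoImplicit false
set_option linter.dupNamespace false

namespace Summit.BirchSwinnertonDyer.BirchSwinnertonDyer.Theorems

/-- **The join of route `SylvesterTwoHeegnerIndex` holds**: the lower and upper halves of the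
`2`-adic Heegner-index identity on 𝒞_HSY and the published facts imply the rung-K7t leaf
`X12.CMAtTwo`, by the kernel bridge `CMRungInputs.cmAtTwo_of_inputs` (p406906).
[cite: GrossZagier1986, V.§2 (pp. 310–312)] [cite: HuShuYin2019, Thm. 1.4 (p. 3)] -/
theorem sylvesterTwoHeegnerIndex_assembly_proof :
    Summit.BirchSwinnertonDyer.BirchSwinnertonDyer.Theses.SylvesterTwoHeegnerIndex.Assembly := by
  unfold Summit.BirchSwinnertonDyer.BirchSwinnertonDyer.Theses.SylvesterTwoHeegnerIndex.Assembly
  intro hlo hup hF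
  exact Summit.BirchSwinnertonDyer.BirchSwinnertonDyer.Rank1Residual.CMRungInputs.cmAtTwo_of_inputs
    hlo hup hF

end Summit.BirchSwinnertonDyer.BirchSwinnertonDyer.Theorems
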